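import Literature.NumberTheory.Automorphic.GLnPlaceSplittingOperators
import HarnessLib

/-!
# Convolution and involution of pure tensors on a product group, and along a splitting
# `P ≃ₜ* G`; the product test functions `θ^{(v)} ⊗ ξ_v` on `GL_n(𝔸_K)`
(Deitmar–Echterhoff, *Principles of harmonic analysis* (2014), §1.6 and Prop. 6.2.1: the
convolution algebra `C_c(G)`; Gelbart, *Automorphic forms on adele groups* (1975), §10, p. 153:
`Φ = (∏_{v ∈ S} f_v) × f`, `Φ ⋆ Φ^*`; Bump (1997), §3.3, Prop. 3.3.2)

Topic `NumberTheory/Automorphic`; theorems only (no definition, no named fact, no instance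
visible to importers). The tree's multiplicative convolution `mulConv η f₁ f₂ (g) = ∫ f₁(u) f₂(u⁻¹ g) dη(u)`
and involution `mulStar f (g) = \overline{f(g⁻¹)}` (`AutomorphicQuotientKernelConvolution`) on a
product group `G₁ × G₂` with a product measure, evaluated on pure tensors
`(e ⊗ f)(x, y) = e(x) f(y)`:

* `mulStar_tensor` — `(e ⊗ f)^* = e^* ⊗ f^*`;
* `mulConv_tensor` — **`(e₁ ⊗ f₁) ⋆ (e₂ ⊗ f₂) = (e₁ ⋆ e₂) ⊗ (f₁ ⋆ f₂)`** for the product measure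
  `η₁ ⊗ η₂` (`MeasureTheory.integral_prod_mul`; no integrability needed);
* `mulStar_comp_continuousMulEquiv`, `mulConv_comp_continuousMulEquiv_of_map_eq_smul` — along a
  topological group isomorphism `E : P ≃ₜ* G` with `(E⁻¹)_* ν = κ η_P`:
  `(Φ₁ ⋆_ν Φ₂) ∘ E = κ · (Φ₁ ∘ E) ⋆_{η_P} (Φ₂ ∘ E)` and `Φ^* ∘ E = (Φ ∘ E)^*`;
* `mulConv_localTestFunction`, `mulStar_localTestFunction` — **on `GL_n(𝔸_K)`**, with the splitting
  `GLn.placeSplitting` and `(splitting⁻¹)_* ν = κ (μ_v ⊗ μ')`: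
  `(θ₁^{(v)} ⊗ ξ₁) ⋆_ν (θ₂^{(v)} ⊗ ξ₂) (ι_v(a) h) = κ (ξ₁ ⋆_{μ_v} ξ₂)(a) (θ₁| ⋆_{μ'} θ₂|)(h)` and
  `(θ^{(v)} ⊗ ξ)^*(ι_v(a) h) = \overline{θ(h⁻¹)} ξ^*(a)` — so the span of the product test functions
  with factors in `*`-subalgebras at `v` and away from `v` is a `*`-algebra for `⋆_ν`, the shape of
  the matched algebras of `TraceComparisonDatumOfTestAlgebra`.

## References

* A. Deitmar, S. Echterhoff, *Principles of harmonic analysis*, 2nd ed. (2014), §1.6, Prop. 6.2.1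
  [DeitmarEchterhoff2014].
* S. Gelbart, *Automorphic forms on adele groups*, Ann. of Math. Studies 83 (1975), §10, p. 153
  [Gelbart1975].
* D. Bump, *Automorphic Forms and Representations* (1997), §3.3, Prop. 3.3.2 [Bump1997].
-/

noncomputable section

open MeasureTheory Measure Set Filter Topology IsDedekindDomain NumberField
open scoped ENNReal NNReal ComplexConjugate

namespace Literature.NumberTheory.Automorphic

/-! ### Pure tensors on a product group -/

section Tensor

variable {G₁ G₂ : Type*} [Group G₁] [Group G₂]

/-- **`(e ⊗ f)^* = e^* ⊗ f^*`.** [folklore] -/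
theorem mulStar_tensor (e : G₁ → ℂ) (f : G₂ → ℂ) :
    mulStar (fun p : G₁ × G₂ => e p.1 * f p.2) = fun p => mulStar e p.1 * mulStar f p.2 := by
  funext p
  simp only [mulStar_apply, Prod.fst_inv, Prod.snd_inv, map_mul]

variable [MeasurableSpace G₁] [MeasurableSpace G₂]

/-- **`(e₁ ⊗ f₁) ⋆ (e₂ ⊗ f₂) = (e₁ ⋆ e₂) ⊗ (f₁ ⋆ f₂)`** for the product measure `η₁ ⊗ η₂`:
`∫∫ e₁(a) f₁(b) e₂(a⁻¹ x) f₂(b⁻¹ y) = (∫ e₁(a) e₂(a⁻¹ x) da)(∫ f₁(b) f₂(b⁻¹ y) db)`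
(`MeasureTheory.integral_prod_mul`). [cite: DeitmarEchterhoff2014, §1.6] -/
theorem mulConv_tensor (η₁ : Measure G₁) (η₂ : Measure G₂) [SFinite η₁] [SFinite η₂]
    (e₁ e₂ : G₁ → ℂ) (f₁ f₂ : G₂ → ℂ) (x : G₁) (y : G₂) :
    mulConv (η₁.prod η₂) (fun p : G₁ × G₂ => e₁ p.1 * f₁ p.2) (fun p => e₂ p.1 * f₂ p.2) (x, y) =
      mulConv η₁ e₁ e₂ x * mulConv η₂ f₁ f₂ y := by
  rw [mulConv_apply, mulConv_apply, mulConv_apply, ← integral_prod_mul]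
  congr 1 with p
  simp only [Prod.fst_inv, Prod.snd_inv, Prod.fst_mul, Prod.snd_mul]
  ring

end Tensor

/-! ### Along a splitting `E : P ≃ₜ* G` -/

section Pullback

variable {P G : Type*} [Group P] [Group G] [TopologicalSpace P] [TopologicalSpace G]
  [MeasurableSpace P] [MeasurableSpace G] [BorelSpace P] [BorelSpace G]

omit [MeasurableSpace P] [MeasurableSpace G] [BorelSpace P] [BorelSpace G] in
/-- `Φ^* ∘ E = (Φ ∘ E)^*` for a homomorphism `E`. [folklore] -/
theorem mulStar_comp_continuousMulEquiv (E : P ≃ₜ* G) (Φ : G → ℂ) :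
    (fun p => mulStar Φ (E p)) = mulStar (fun p => Φ (E p)) := by
  funext p
  simp only [mulStar_apply, map_inv]

/-- **`(Φ₁ ⋆_ν Φ₂)(E p) = κ · ((Φ₁ ∘ E) ⋆_{η_P} (Φ₂ ∘ E))(p)`** along a topological group
isomorphism `E : P ≃ₜ* G` with `(E⁻¹)_* ν = κ η_P` (change of variables `u = E q` and
`(E q)⁻¹ E p = E (q⁻¹ p)`). [folklore] -/
theorem mulConv_comp_continuousMulEquiv_of_map_eq_smul (E : P ≃ₜ* G) (ν : Measure G)
    (ηP : Measure P) {κ : ℝ≥0} (hκ : Measure.map E.symm ν = κ • ηP) (Φ₁ Φ₂ : G → ℂ) (p : P) :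
    mulConv ν Φ₁ Φ₂ (E p) = (κ : ℂ) * mulConv ηP (fun q => Φ₁ (E q)) (fun q => Φ₂ (E q)) p := by
  rw [mulConv_apply, mulConv_apply]
  set em : G ≃ᵐ P := E.symm.toHomeomorph.toMeasurableEquiv with hem
  have hem' : (em : G → P) = E.symm := rfl
  have h1 : ∫ u, Φ₁ u * Φ₂ (u⁻¹ * E p) ∂ν =
      ∫ q, Φ₁ (E q) * Φ₂ ((E q)⁻¹ * E p) ∂(Measure.map E.symm ν) := by
    rw [← hem', integral_map_equiv]
    simp only [hem', ContinuousMulEquiv.apply_symm_apply]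
  rw [h1, hκ, integral_smul_nnreal_measure, NNReal.smul_def, ← Complex.coe_smul, smul_eq_mul]
  congr 1
  refine integral_congr_ae (Eventually.of_forall fun q => ?_)
  simp only [map_mul, map_inv]

end Pullback

/-! ### `GL_n(𝔸_K)`: convolution and involution of the product test functions -/

section GLn

variable {n : ℕ} {K : Type} [Field K] [NumberField K] {v : HeightOneSpectrum (𝓞 K)}

attribute [local instance] adelicBorel borelSpace_adelic locallyCompactSpace_adelic
  secondCountableTopology_gl_adelic

/-- **Convolution of product test functions on `GL_n(𝔸_K)`**: with `(splitting⁻¹)_* ν = κ (μ_v ⊗ μ')`,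
`(θ₁^{(v)} ⊗ ξ₁) ⋆_ν (θ₂^{(v)} ⊗ ξ₂) (ι_v(a) h) = κ · (ξ₁ ⋆_{μ_v} ξ₂)(a) · (θ₁| ⋆_{μ'} θ₂|)(h)`,
`θ_i|` the restrictions to `G^{(v)}` (as complex functions). [cite: Gelbart1975, §10 p. 153] -/
theorem mulConv_localTestFunction
    [MeasurableSpace (GL (Fin n) (v.adicCompletion K))] [BorelSpace (GL (Fin n) (v.adicCompletion K))]
    [SecondCountableTopology (GL (Fin n) (v.adicCompletion K))]
    (ν : Measure (AdelicGroupData.gl n K).Adelic)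
    (μv : Measure (GL (Fin n) (v.adicCompletion K))) [SFinite μv]
    (μ' : Measure ((GLn.toLocalAt n K v).ker : Subgroup (AdelicGroupData.gl n K).Adelic)) [SFinite μ']
    {κ : ℝ≥0} (hκ : Measure.map (GLn.placeSplitting n K v).symm ν = κ • μv.prod μ')
    (θ₁ θ₂ : (AdelicGroupData.gl n K).Adelic → ℝ) (ξ₁ ξ₂ : GL (Fin n) (v.adicCompletion K) → ℂ)
    (p : GL (Fin n) (v.adicCompletion K) × ((GLn.toLocalAt n K v).ker : Subgroup (AdelicGroupData.gl n K).Adelic)) :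
    mulConv ν (localTestFunction v θ₁ ξ₁) (localTestFunction v θ₂ ξ₂) (GLn.placeSplitting n K v p) =
      (κ : ℂ) * (mulConv μv ξ₁ ξ₂ p.1 *
        mulConv μ' (fun h : ((GLn.toLocalAt n K v).ker : Subgroup (AdelicGroupData.gl n K).Adelic) =>
            (θ₁ (h : (AdelicGroupData.gl n K).Adelic) : ℂ))
          (fun h => (θ₂ (h : (AdelicGroupData.gl n K).Adelic) : ℂ)) p.2) := by
  haveI : T2Space (AdelicGroupData.gl n K).Adelic := t2Space_gl n K
  haveI : BorelSpace ((GLn.toLocalAt n K v).ker : Subgroup (AdelicGroupData.gl n K).Adelic) :=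
    Subtype.borelSpace _
  haveI : SecondCountableTopology ((GLn.toLocalAt n K v).ker : Subgroup (AdelicGroupData.gl n K).Adelic) :=
    TopologicalSpace.Subtype.secondCountableTopology _
  haveI : BorelSpace (GL (Fin n) (v.adicCompletion K) ×
      ((GLn.toLocalAt n K v).ker : Subgroup (AdelicGroupData.gl n K).Adelic)) := Prod.borelSpace
  rw [mulConv_comp_continuousMulEquiv_of_map_eq_smul (GLn.placeSplitting n K v) ν (μv.prod μ') hκ]
  congr 1
  have h1 : (fun q => localTestFunction v θ₁ ξ₁ (GLn.placeSplitting n K v q)) =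
      fun q => ξ₁ q.1 * (θ₁ (q.2 : (AdelicGroupData.gl n K).Adelic) : ℂ) := by
    funext q
    rw [localTestFunction_placeSplitting, mul_comm]
  have h2 : (fun q => localTestFunction v θ₂ ξ₂ (GLn.placeSplitting n K v q)) =
      fun q => ξ₂ q.1 * (θ₂ (q.2 : (AdelicGroupData.gl n K).Adelic) : ℂ) := by
    funext q
    rw [localTestFunction_placeSplitting, mul_comm]
  rw [h1, h2]
  exact mulConv_tensor μv μ' ξ₁ ξ₂
    (fun h : ((GLn.toLocalAt n K v).ker : Subgroup (AdelicGroupData.gl n K).Adelic) =>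
      (θ₁ (h : (AdelicGroupData.gl n K).Adelic) : ℂ))
    (fun h => (θ₂ (h : (AdelicGroupData.gl n K).Adelic) : ℂ)) p.1 p.2

/-- **Involution of a product test function on `GL_n(𝔸_K)`**:
`(θ^{(v)} ⊗ ξ)^*(ι_v(a) h) = \\overline{θ(h⁻¹)} · ξ^*(a)`. [cite: Gelbart1975, §10 p. 153] -/
theorem mulStar_localTestFunction (θ : (AdelicGroupData.gl n K).Adelic → ℝ)
    (ξ : GL (Fin n) (v.adicCompletion K) → ℂ)
    (p : GL (Fin n) (v.adicCompletion K) × ((GLn.toLocalAt n K v).ker : Subgroup (AdelicGroupData.gl n K).Adelic)) :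
    mulStar (localTestFunction v θ ξ) (GLn.placeSplitting n K v p) =
      (θ ((p.2 : (AdelicGroupData.gl n K).Adelic)⁻¹) : ℂ) * mulStar ξ p.1 := by
  rw [mulStar_apply, ← map_inv, localTestFunction_placeSplitting, map_mul, mulStar_apply,
    Complex.conj_ofReal, Prod.snd_inv, Prod.fst_inv, Subgroup.coe_inv]

end GLn

end Literature.NumberTheory.Automorphic
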